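import Summits.BirchSwinnertonDyer.BirchSwinnertonDyer.Theorems.ResidualThetaTransportAtTwoResidualSignedLambdaLowerCMAtTwoRhoLayerPairingCompat
import Summits.BirchSwinnertonDyer.BirchSwinnertonDyer.Theorems.ThetaPartnerAtTwoSignedKatoUpToAtTwoLayerPairingCompat
import Literature.NumberTheory.GaloisRepresentations.LocalKummerTorsion
import Literature.NumberTheory.EllipticCurves.GreenbergSelmerCofreeGaloisModule
import HarnessLib

/-!
# The INCLUSIONS of the `2^k`-torsion tower: `ι : A_ρ[p^k] ↪ A_ρ[p^{k+1}]`, its local form, and `μ_{p^k}| ↪ μ_{p^{k+1}}|` — the maps adjoint to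
# `[p]` (`cofreeTorsionPow`) and `(·)^p` (`muLocalPow`) under the layer Tate pairings (definitions)

Route `ResidualThetaTransportAtTwo` (RTT), crux RSL_g `ResidualSignedLambdaLowerCMAtTwo` (stmt-BirchSwinnertonDyer-22608), stub S4₀ `stub_deepHalfAwayTwo`;
seat `prover-bsd-wall-tp2-p2x` g19 (`--supports 22608 --as helper`, closes nothing). DEFINITIONS with bodies + `rfl`/unfolding lemmas (no named fact, no
instance, no notation, no `sorry`); companion of `cofreeTorsionPow` (`…RhoLayerPairingCompat`, p676533) and TP2's `muLocalPow` (`…LayerPairingCompat`).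
BSD is not proved by any of this; RSL_g is not proved here.

WHY. The S₀-side characters of the S4₀ text are read on `H¹(U_{n,w}, A_ρ[2^k]|)` through `j_{n,k}` (`AwayPins.hlocdS`), and `j_{n,k+1} ∘ ι_* = j_{n,k}`:
the character-built local classes of `AwayCharacterReadback` at the levels `2^k` and `2^{k+1}` are compared through the MIXED projection formula
`⟨[2]_* b', y⟩_k ↔ ⟨b', ι_* y⟩_{k+1}`, whose cohomological side (`ContPairing.cupProduct_coindFin_map_adjoint`, `Prop121vii.invariantMap_muInclHom_compat`)
needs `ι` and `μ_{2^k} ↪ μ_{2^{k+1}}` as MORPHISMS of topological representations. This file only names them: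

* `cofreeTorsionIncl S ρ k : A_ρ[p^k] ⟶ A_ρ[p^{k+1}]` (`a ↦ a`), `coe_cofreeTorsionIncl_apply`, `cofreeTorsionPow_cofreeTorsionIncl` (`[p] ∘ ι = p •`),
  `cofreeTorsionIncl_cofreeTorsionPow` (`ι ∘ [p] = p •`), `cofreeTorsionInclusion_cofreeTorsionIncl` (`(A[p^{k+1}] ↪ A) ∘ ι = (A[p^k] ↪ A)`);
* `cofreeTorsionLocalIncl S ρ k v` (restriction to `Γ_v`), `cofreeTorsionLocalInclusion_cofreeTorsionLocalIncl`;
* `muLocalIncl k v : μ_{p^k}|_{Γ_v} ⟶ μ_{p^{k+1}}|_{Γ_v}` (the tree's `muInclHom` restricted), `muVal_muLocalIncl`.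

References: [Kato2004Asterisque] §13.8 (p. 228); [SilvermanAEC2009] III.8.1; [SerreLocalFields1979] XIII §3.
-/

set_option autoImplicit false
-- the Theorems namespace of this sub repeats the summit name by design (D-0017 nested layout)
set_option linter.dupNamespace false

noncomputable section

open scoped Classical

namespace Summit.BirchSwinnertonDyer.BirchSwinnertonDyer.Theorems.ThetaTransport

open CategoryTheory Field NumberField IsDedekindDomain
  Literature.NumberTheory.EllipticCurves Literature.NumberTheory.GaloisRepresentations
  Literature.NumberTheory.EllipticCurves.GreenbergSelmer Literature.NumberTheory.EllipticCurves.CyclotomicLayer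
  Literature.NumberTheory.GaloisRepresentations.DiscreteGaloisModule

variable {p : ℕ} [Fact p.Prime] (S : Set (PadicAlgCl p)) {d : ℕ} (ρ : FramedGaloisRep ℚ ↥(padicCoeffIntegers S) d) (k : ℕ)

/-! ## §1 `ι : A_ρ[p^k] ⟶ A_ρ[p^{k+1}]` -/

/-- `1 • a ∈ A_ρ[p^{k+1}]` for `a ∈ A_ρ[p^k]` (the inclusion is written `a ↦ 1 • a`, the kernel-friendly twin of `cofreeTorsionPow`'s `a ↦ p • a`).
[cite: Kato2004Asterisque, §13.8 (p. 228)] -/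
theorem one_zsmul_mem_cofreeTorsionBy_pow_succ (a : ↥(AddSubgroup.torsionBy (Cofree ρ ↥(padicCoeffField S)) ((p ^ k : ℕ) : ℤ))) :
    (1 : ℤ) • (a : Cofree ρ ↥(padicCoeffField S)) ∈ AddSubgroup.torsionBy (Cofree ρ ↥(padicCoeffField S)) ((p ^ (k + 1) : ℕ) : ℤ) := by
  refine (Submodule.mem_torsionBy_iff (R := ℤ) _ _).mpr ?_
  rw [one_zsmul]
  have h : ((p ^ (k + 1) : ℕ) : ℤ) = (p : ℤ) * ((p ^ k : ℕ) : ℤ) := by push_cast; ring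
  rw [h, mul_smul, (Submodule.mem_torsionBy_iff (R := ℤ) _ _).mp a.2, smul_zero]

/-- **`ι : A_ρ[p^k] ⟶ A_ρ[p^{k+1}]`**, the inclusion (written `a ↦ 1 • a`), as a morphism of the discrete `Γ_ℚ`-modules.
[cite: Kato2004Asterisque, §13.8 (p. 228)] -/
def cofreeTorsionIncl :
    (cofreeTorsionGaloisModule S ρ ((p ^ k : ℕ) : ℤ)).toTopRep ⟶ (cofreeTorsionGaloisModule S ρ ((p ^ (k + 1) : ℕ) : ℤ)).toTopRep :=
  TopRep.ofHom
    { toContinuousLinearMap :=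
        { toFun := fun a ↦ ⟨(1 : ℤ) • (a : Cofree ρ ↥(padicCoeffField S)), one_zsmul_mem_cofreeTorsionBy_pow_succ S ρ k a⟩
          map_add' := fun a b ↦ Subtype.ext (by
            change (1 : ℤ) • ((a : Cofree ρ ↥(padicCoeffField S)) + (b : Cofree ρ ↥(padicCoeffField S))) =
              (1 : ℤ) • (a : Cofree ρ ↥(padicCoeffField S)) + (1 : ℤ) • (b : Cofree ρ ↥(padicCoeffField S))
            rw [zsmul_add])
          map_smul' := fun c a ↦ Subtype.ext (by
            change (1 : ℤ) • (c • (a : Cofree ρ ↥(padicCoeffField S))) = c • ((1 : ℤ) • (a : Cofree ρ ↥(padicCoeffField S)))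
            rw [smul_comm])
          cont := continuous_of_discreteTopology }
      isIntertwining' := fun σ ↦ by
        ext a
        change (1 : ℤ) • ((cofreeTorsionGaloisModule S ρ _ σ a : ↥(AddSubgroup.torsionBy _ _)) : Cofree ρ ↥(padicCoeffField S)) =
          σ • ((1 : ℤ) • (a : Cofree ρ ↥(padicCoeffField S)))
        rw [cofreeTorsionGaloisModule_apply_apply, Literature.NumberTheory.EllipticCurves.AddSubgroup.torsionBy.coe_smul]
        exact (map_zsmul (DistribSMul.toAddMonoidHom (Cofree ρ ↥(padicCoeffField S)) σ) (1 : ℤ) (a : Cofree ρ ↥(padicCoeffField S))).symm }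

/-- Raw values of `cofreeTorsionIncl`: `a ↦ 1 • a` (definitional). [cite: Kato2004Asterisque, §13.8 (p. 228)] -/
theorem coe_cofreeTorsionIncl_apply' (a : ↥(AddSubgroup.torsionBy (Cofree ρ ↥(padicCoeffField S)) ((p ^ k : ℕ) : ℤ))) :
    (((cofreeTorsionIncl S ρ k).hom a : ↥(AddSubgroup.torsionBy (Cofree ρ ↥(padicCoeffField S)) ((p ^ (k + 1) : ℕ) : ℤ))) :
      Cofree ρ ↥(padicCoeffField S)) = (1 : ℤ) • (a : Cofree ρ ↥(padicCoeffField S)) := rfl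

/-- Values of `cofreeTorsionIncl`: `a ↦ a`. [cite: Kato2004Asterisque, §13.8 (p. 228)] -/
@[simp] theorem coe_cofreeTorsionIncl_apply (a : ↥(AddSubgroup.torsionBy (Cofree ρ ↥(padicCoeffField S)) ((p ^ k : ℕ) : ℤ))) :
    (((cofreeTorsionIncl S ρ k).hom a : ↥(AddSubgroup.torsionBy (Cofree ρ ↥(padicCoeffField S)) ((p ^ (k + 1) : ℕ) : ℤ))) :
      Cofree ρ ↥(padicCoeffField S)) = (a : Cofree ρ ↥(padicCoeffField S)) := by
  rw [coe_cofreeTorsionIncl_apply', one_zsmul]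

/-- `[p] ∘ ι = p •` on `A_ρ[p^k]`. [cite: Kato2004Asterisque, §13.8 (p. 228)] -/
theorem cofreeTorsionPow_cofreeTorsionIncl (a : ↥(AddSubgroup.torsionBy (Cofree ρ ↥(padicCoeffField S)) ((p ^ k : ℕ) : ℤ))) :
    (cofreeTorsionPow S ρ k).hom ((cofreeTorsionIncl S ρ k).hom a) = (p : ℤ) • a :=
  Subtype.ext (by rw [coe_cofreeTorsionPow_apply, coe_cofreeTorsionIncl_apply, AddSubgroupClass.coe_zsmul])

/-- `ι ∘ [p] = p •` on `A_ρ[p^{k+1}]`. [cite: Kato2004Asterisque, §13.8 (p. 228)] -/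
theorem cofreeTorsionIncl_cofreeTorsionPow (a : ↥(AddSubgroup.torsionBy (Cofree ρ ↥(padicCoeffField S)) ((p ^ (k + 1) : ℕ) : ℤ))) :
    (cofreeTorsionIncl S ρ k).hom ((cofreeTorsionPow S ρ k).hom a) = (p : ℤ) • a :=
  Subtype.ext (by rw [coe_cofreeTorsionIncl_apply, coe_cofreeTorsionPow_apply, AddSubgroupClass.coe_zsmul])

/-- `(A_ρ[p^{k+1}] ↪ A_ρ) ∘ ι = (A_ρ[p^k] ↪ A_ρ)`. [cite: Kato2004Asterisque, §13.8 (p. 228)] -/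
theorem cofreeTorsionInclusion_cofreeTorsionIncl (a : ↥(AddSubgroup.torsionBy (Cofree ρ ↥(padicCoeffField S)) ((p ^ k : ℕ) : ℤ))) :
    (cofreeTorsionInclusion S ρ ((p ^ (k + 1) : ℕ) : ℤ)).hom ((cofreeTorsionIncl S ρ k).hom a) =
      (cofreeTorsionInclusion S ρ ((p ^ k : ℕ) : ℤ)).hom a := by
  rw [cofreeTorsionInclusion_apply, cofreeTorsionInclusion_apply, coe_cofreeTorsionIncl_apply]

/-! ## §2 The local forms at a finite place `v` -/

variable (v : HeightOneSpectrum (𝓞 ℚ))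

/-- **`ι|_{Γ_v} : A_ρ[p^k]|_{Γ_v} ⟶ A_ρ[p^{k+1}]|_{Γ_v}`**. [cite: Kato2004Asterisque, §13.8 (p. 228)] -/
def cofreeTorsionLocalIncl :
    localRepOf (cofreeTorsionGaloisModule S ρ ((p ^ k : ℕ) : ℤ)) v ⟶ localRepOf (cofreeTorsionGaloisModule S ρ ((p ^ (k + 1) : ℕ) : ℤ)) v :=
  TopRep.ofHom ((cofreeTorsionIncl S ρ k).hom.restrictField (v.adicCompletion ℚ))

/-- The local form has the same underlying map. [cite: Kato2004Asterisque, §13.8 (p. 228)] -/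
theorem cofreeTorsionLocalIncl_apply (a : ↥(AddSubgroup.torsionBy (Cofree ρ ↥(padicCoeffField S)) ((p ^ k : ℕ) : ℤ))) :
    (cofreeTorsionLocalIncl S ρ k v).hom a = (cofreeTorsionIncl S ρ k).hom a := rfl

/-- Values of `cofreeTorsionLocalIncl`. [cite: Kato2004Asterisque, §13.8 (p. 228)] -/
@[simp] theorem coe_cofreeTorsionLocalIncl_apply (a : ↥(AddSubgroup.torsionBy (Cofree ρ ↥(padicCoeffField S)) ((p ^ k : ℕ) : ℤ))) :
    (((cofreeTorsionLocalIncl S ρ k v).hom a : ↥(AddSubgroup.torsionBy (Cofree ρ ↥(padicCoeffField S)) ((p ^ (k + 1) : ℕ) : ℤ))) :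
      Cofree ρ ↥(padicCoeffField S)) = (a : Cofree ρ ↥(padicCoeffField S)) := by
  rw [cofreeTorsionLocalIncl_apply, coe_cofreeTorsionIncl_apply]

/-- `(A_ρ[p^{k+1}]| ↪ A_ρ|) ∘ ι| = (A_ρ[p^k]| ↪ A_ρ|)` on the local coefficient modules. [cite: Kato2004Asterisque, §13.8 (p. 228)] -/
theorem cofreeTorsionLocalInclusion_cofreeTorsionLocalIncl (a : ↥(AddSubgroup.torsionBy (Cofree ρ ↥(padicCoeffField S)) ((p ^ k : ℕ) : ℤ))) :
    (cofreeTorsionLocalInclusion S ρ ((p ^ (k + 1) : ℕ) : ℤ) v).hom ((cofreeTorsionLocalIncl S ρ k v).hom a) =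
      (cofreeTorsionLocalInclusion S ρ ((p ^ k : ℕ) : ℤ) v).hom a := by
  rw [cofreeTorsionLocalIncl_apply, cofreeTorsionLocalInclusion_apply, cofreeTorsionLocalInclusion_apply, coe_cofreeTorsionIncl_apply]

/-- `ι| ∘ [p]| = p •` on the local coefficient module `A_ρ[p^{k+1}]|`. [cite: Kato2004Asterisque, §13.8 (p. 228)] -/
theorem cofreeTorsionLocalIncl_cofreeTorsionLocalPow (a : ↥(AddSubgroup.torsionBy (Cofree ρ ↥(padicCoeffField S)) ((p ^ (k + 1) : ℕ) : ℤ))) :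
    (cofreeTorsionLocalIncl S ρ k v).hom ((cofreeTorsionLocalPow S ρ k v).hom a) = (p : ℤ) • a :=
  cofreeTorsionIncl_cofreeTorsionPow S ρ k a

/-- **`μ_{p^k}|_{Γ_v} ⟶ μ_{p^{k+1}}|_{Γ_v}`**, the inclusion of roots of unity (the tree's `muInclHom` restricted to `Γ_v`) — adjoint to TP2's
`muLocalPow` (`(·)^p`); arguments `(k) (v)`. [cite: SerreLocalFields1979, XIII §3] -/
def muLocalIncl : muLocalRep (p ^ k) v ⟶ muLocalRep (p ^ (k + 1)) v :=
  TopRep.ofHom ((muInclHom ℚ (Dvd.intro p (SignedKatoOffTwo.LayerPairing.pow_mul_prime_eq k))).hom.restrictField (v.adicCompletion ℚ))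

omit [Fact p.Prime] in
/-- Values of `muLocalIncl`: the tree's `muInclusion`. [cite: SerreLocalFields1979, XIII §3] -/
theorem muLocalIncl_hom_apply (x : MuCarrier ℚ (p ^ k)) :
    (muLocalIncl k v).hom x = muInclusion ℚ (Dvd.intro p (SignedKatoOffTwo.LayerPairing.pow_mul_prime_eq k)) x := rfl

omit [Fact p.Prime] in
/-- Values of `muLocalIncl` on underlying units: `ζ ↦ ζ`. [cite: SerreLocalFields1979, XIII §3] -/
@[simp] theorem muVal_muLocalIncl [NeZero (p ^ k)] [NeZero (p ^ (k + 1))] (x : MuCarrier ℚ (p ^ k)) :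
    muVal ℚ (p ^ (k + 1)) ((muLocalIncl k v).hom x) = muVal ℚ (p ^ k) x := by
  rw [muLocalIncl_hom_apply, muVal_muInclusion]

end Summit.BirchSwinnertonDyer.BirchSwinnertonDyer.Theorems.ThetaTransport

end
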